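import Summits.NavierStokesRegularity.FunctionalMining.SaturatingLawStatic
import HarnessLib

/-!
# FunctionalMining — Lemma 0 (ii) at the level of the static rate bound: the all-fields multiplicative criterion is EQUIVALENT to the static bound of `T_LD_κ` (census-2 seat, v3 addendum)

Search for candidate a priori estimates; no regularity claim. Cell `pub-nsfunc`, census-2 seat
(gen 38), filed by the prove seat (gen 23) as the second half of the staged file
`pub-nsfunc-census-2/lean/lemma0-B/v3/SaturatingLawStatic.lean` (sha16 b03c1465e226ddac; split only
because Theorems files are ≤ 400 lines — declarations byte-identical). Sequel of
`SaturatingLawStatic.lean` (`HasRateEverywhere`, `StaticRateBound`, Lemma 0 (⇐), the constant `c_γ`,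
`staticRateBound_of_mul_rpow`, `saturatingLaw_of_mul_rpow`). Here:

* `nonneg_of_rate_family` — the family `N − νD ≤ ν^{−γ}B'` for all `ν > 0` forces `D ≥ 0` (`ν → ∞`);
* `nonpos_of_rate_family_budget_zero` — `D > 0`, `B' = 0` forces `N ≤ 0` (`ν → 0`);
* `mul_rpow_of_staticRateBound` — (⇒) at every datum, degenerate data included via `Real.zero_rpow`;
* `staticRateBound_iff_mul_rpow`, **`saturatingLaw_iff_mul_rpow`** — SIEVELD §0 Lemma 0 typed end
  to end for functionals with rates at every time: `SaturatingLaw F σ γ κ` IFF the all-fields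
  criterion `D₀ ≥ 0 ∧ N ≤ c_γ D₀^{γ/(1+γ)} (κ (2ℰ) F^{1+1/σ})^{1/(1+γ)}` at every datum (the no-go
  seat's canonical form of the criterion, QN4-NOTE-ADD1 §A1.8 (iv), `(1+γ)`-th-root version).

Not here: the one-sided spectral cores (`SaturatingLawSup`), anything about which functionals
satisfy the criterion, any verdict of the cell's table.

[ours, bookkeeping; SIEVELD §0 Lemma 0 (ii)]
-/


noncomputable section

open MeasureTheory Set Filter Topology

namespace Summit.NavierStokesRegularity.FunctionalMining

open Literature.Analysis.FunctionSpaces Literature.Analysis.FluidPDE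

variable {d : Type*} [Fintype d] [DecidableEq d]

/-! ## Lemma 0 (ii) at the level of the static rate bound: the all-fields criterion is EQUIVALENT to the static bound of `T_LD_κ` -/

/-- **A negative dissipation rate kills the family.** If `γ > 0` and `N − ν D ≤ ν^{−γ} B'` for every
`ν > 0`, then `D ≥ 0` (for `D < 0` the left side tends to `+∞` and the right side to `0` as
`ν → ∞`). [ours; SIEVELD §0 Lemma 0 (ii), sign of `D₀`] -/
theorem nonneg_of_rate_family {γ N D B' : ℝ} (hγ : 0 < γ)
    (h : ∀ ν : ℝ, 0 < ν → N - ν * D ≤ ν ^ (-γ) * B') : 0 ≤ D := by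
  refine le_of_not_gt fun hD => ?_
  have ht : Filter.Tendsto (fun ν : ℝ => ν ^ (-γ) * B') Filter.atTop (nhds (0 * B')) :=
    (tendsto_rpow_neg_atTop hγ).mul_const B'
  rw [zero_mul] at ht
  have h1 : Filter.Tendsto (fun ν : ℝ => N + (-D) * ν) Filter.atTop Filter.atTop :=
    Filter.tendsto_atTop_add_const_left _ _ (Filter.tendsto_id.const_mul_atTop (neg_pos.mpr hD))
  have hev : ∀ᶠ ν in Filter.atTop, ν ^ (-γ) * B' < 1 ∧ 1 < N + (-D) * ν :=
    (ht.eventually (gt_mem_nhds zero_lt_one)).and (h1.eventually_gt_atTop 1)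
  obtain ⟨ν, ⟨hlt, hgt⟩, hνpos⟩ := (hev.and (Filter.eventually_gt_atTop 0)).exists
  have := h ν hνpos
  have : N - ν * D = N + (-D) * ν := by ring
  linarith

/-- **A vanishing budget factor forces non-positive production.** If `D > 0` and `N − ν D ≤ 0`
for every `ν > 0`, then `N ≤ 0` (let `ν → 0`). [ours; SIEVELD §0 Lemma 0 (ii), `B' = 0` clause] -/
theorem nonpos_of_rate_family_budget_zero {N D : ℝ} (hD : 0 < D)
    (h : ∀ ν : ℝ, 0 < ν → N - ν * D ≤ 0) : N ≤ 0 := by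
  refine le_of_not_gt fun hN => ?_
  have hν : 0 < N / (2 * D) := div_pos hN (by linarith)
  have := h _ hν
  have hcalc : N / (2 * D) * D = N / 2 := by field_simp
  linarith

/-- **Lemma 0 (ii) at every datum, ⇒: the static rate bound of `T_LD_κ(F; σ, γ)` with viscous rate
`−D₀` forces, at every smooth divergence-free zero-mean datum, `D₀ u₀ ≥ 0` and the multiplicative
bound `N u₀ ≤ c_γ (D₀ u₀)^{γ/(1+γ)} (κ (2ℰ u₀) (F u₀)^{1+1/σ})^{1/(1+γ)}`** (for `γ > 0`, `κ ≥ 0`,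
`F ≥ 0`). The degenerate data are covered by the `Real.rpow` conventions: `D₀ u₀ = 0` forces
`N u₀ ≤ 0 = c_γ · 0 · (…)` (`nonpos_of_rate_family_zero`), and a vanishing budget factor with
`D₀ u₀ > 0` forces `N u₀ ≤ 0 = c_γ (…) · 0` (`nonpos_of_rate_family_budget_zero`). This is the
no-go seat's canonical all-fields form of the criterion (QN4-NOTE-ADD1 §A1.8 (iv)), (1+γ)-th-root
version. [ours; SIEVELD §0 Lemma 0 (ii)] -/
theorem mul_rpow_of_staticRateBound {F N D₀ : (UnitAddTorus d → EuclideanSpace ℝ d) → ℝ}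
    {σ γ κ : ℝ} (hγ : 0 < γ) (hκ : 0 ≤ κ) (hF : ∀ v, 0 ≤ F v)
    (h : StaticRateBound N (fun v => -D₀ v)
      (fun ν v => κ * ν ^ (-γ) * (2 * torusEnstrophy v) * F v ^ (1 + σ⁻¹))) :
    ∀ ⦃u₀ : UnitAddTorus d → EuclideanSpace ℝ d⦄, Torus.IsSmooth u₀ → Torus.IsDivFree u₀ →
      Torus.HasZeroMean u₀ → 0 ≤ D₀ u₀ ∧
        N u₀ ≤ (1 + γ) * γ ^ (-(γ / (1 + γ))) * (D₀ u₀ ^ (γ / (1 + γ)) *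
          (κ * (2 * torusEnstrophy u₀) * F u₀ ^ (1 + σ⁻¹)) ^ (1 / (1 + γ))) := by
  intro u₀ hu₀ hdiv hmean
  set B' := κ * (2 * torusEnstrophy u₀) * F u₀ ^ (1 + σ⁻¹) with hB'def
  have hB' : 0 ≤ B' :=
    mul_nonneg (mul_nonneg hκ (by linarith [torusEnstrophy_nonneg u₀])) (Real.rpow_nonneg (hF u₀) _)
  have hfam : ∀ ν : ℝ, 0 < ν → N u₀ - ν * D₀ u₀ ≤ ν ^ (-γ) * B' := by
    intro ν hν
    have := h hν hu₀ hdiv hmean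
    have h1 : N u₀ + ν * -D₀ u₀ = N u₀ - ν * D₀ u₀ := by ring
    have h2 : κ * ν ^ (-γ) * (2 * torusEnstrophy u₀) * F u₀ ^ (1 + σ⁻¹) = ν ^ (-γ) * B' := by
      rw [hB'def]; ring
    linarith
  have hD : 0 ≤ D₀ u₀ := nonneg_of_rate_family hγ hfam
  refine ⟨hD, ?_⟩
  have h1γ : 0 < 1 + γ := by linarith
  have hw₁ : γ / (1 + γ) ≠ 0 := ne_of_gt (div_pos hγ h1γ)
  have hw₂ : 1 / (1 + γ) ≠ 0 := ne_of_gt (div_pos one_pos h1γ)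
  rcases hD.eq_or_lt with hD0 | hDpos
  · -- `D₀ u₀ = 0`: the family reads `N ≤ ν^{−γ} B'`, so `N ≤ 0`, and the right side vanishes.
    have hN : N u₀ ≤ 0 := by
      refine nonpos_of_rate_family_zero (B' := B') hγ fun ν hν => ?_
      have := hfam ν hν
      rw [← hD0, mul_zero, sub_zero] at this
      exact this
    rw [← hD0, Real.zero_rpow hw₁, zero_mul, mul_zero]
    exact hN
  rcases hB'.eq_or_lt with hB0 | hBpos
  · -- `B' = 0 < D₀ u₀`: the family reads `N − ν D₀ ≤ 0`, so `N ≤ 0`, and the right side vanishes.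
    have hN : N u₀ ≤ 0 := by
      refine nonpos_of_rate_family_budget_zero hDpos fun ν hν => ?_
      have := hfam ν hν
      rw [← hB0, mul_zero] at this
      exact this
    rw [← hB0, Real.zero_rpow hw₂, mul_zero, mul_zero]
    exact hN
  · exact mul_rpow_le_of_rate_family hγ hDpos hBpos hfam

/-- **Lemma 0 (ii) at the level of the static bound, both directions.** For `γ > 0`, `κ ≥ 0`,
`F ≥ 0`: the static rate bound of `T_LD_κ(F; σ, γ)` with rates `(N, −D₀)` holds at every datum and
every `ν > 0` IFF at every smooth divergence-free zero-mean datum `D₀ ≥ 0` and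
`N ≤ c_γ D₀^{γ/(1+γ)} (κ (2ℰ) F^{1+1/σ})^{1/(1+γ)}`. [ours; SIEVELD §0 Lemma 0 (ii)] -/
theorem staticRateBound_iff_mul_rpow {F N D₀ : (UnitAddTorus d → EuclideanSpace ℝ d) → ℝ}
    {σ γ κ : ℝ} (hγ : 0 < γ) (hκ : 0 ≤ κ) (hF : ∀ v, 0 ≤ F v) :
    StaticRateBound N (fun v => -D₀ v)
        (fun ν v => κ * ν ^ (-γ) * (2 * torusEnstrophy v) * F v ^ (1 + σ⁻¹)) ↔
      ∀ ⦃u₀ : UnitAddTorus d → EuclideanSpace ℝ d⦄, Torus.IsSmooth u₀ → Torus.IsDivFree u₀ →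
        Torus.HasZeroMean u₀ → 0 ≤ D₀ u₀ ∧
          N u₀ ≤ (1 + γ) * γ ^ (-(γ / (1 + γ))) * (D₀ u₀ ^ (γ / (1 + γ)) *
            (κ * (2 * torusEnstrophy u₀) * F u₀ ^ (1 + σ⁻¹)) ^ (1 / (1 + γ))) :=
  ⟨mul_rpow_of_staticRateBound hγ hκ hF, staticRateBound_of_mul_rpow hγ hκ hF⟩

/-- **SIEVELD §0 Lemma 0, typed end to end for functionals with rates at every time.** For
`γ > 0`, `κ ≥ 0`, `F ≥ 0` with inertial rate `N` and viscous rate `−D₀` at every time (on `T³`):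
`SaturatingLaw F σ γ κ` IFF the all-fields multiplicative criterion holds —
`D₀ u₀ ≥ 0` and `N u₀ ≤ c_γ (D₀ u₀)^{γ/(1+γ)} (κ (2ℰ u₀) (F u₀)^{1+1/σ})^{1/(1+γ)}` at every smooth
divergence-free zero-mean datum. Search for candidate a priori estimates; no regularity claim.
[ours; SIEVELD §0 Lemma 0 (⇐), (⇒), (ii)] -/
theorem saturatingLaw_iff_mul_rpow {F N D₀ : (UnitAddTorus d → EuclideanSpace ℝ d) → ℝ}
    {σ γ κ : ℝ} (hγ : 0 < γ) (hκ : 0 ≤ κ) (hF : ∀ v, 0 ≤ F v)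
    (hNV : HasRateEverywhere F N (fun v => -D₀ v)) (hd : Fintype.card d = 3) :
    SaturatingLaw (d := d) F σ γ κ ↔
      ∀ ⦃u₀ : UnitAddTorus d → EuclideanSpace ℝ d⦄, Torus.IsSmooth u₀ → Torus.IsDivFree u₀ →
        Torus.HasZeroMean u₀ → 0 ≤ D₀ u₀ ∧
          N u₀ ≤ (1 + γ) * γ ^ (-(γ / (1 + γ))) * (D₀ u₀ ^ (γ / (1 + γ)) *
            (κ * (2 * torusEnstrophy u₀) * F u₀ ^ (1 + σ⁻¹)) ^ (1 / (1 + γ))) :=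
  (saturatingLaw_iff_staticRateBound hNV hd).trans (staticRateBound_iff_mul_rpow hγ hκ hF)

end Summit.NavierStokesRegularity.FunctionalMining
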